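import Literature.Geometry.Kaehler.ComplexTorusCorrespondenceRingIsogenyInvariance
import Literature.Geometry.Kaehler.ComplexTorusHodgeCorrespondencesWeightOneAlgebraic
import HarnessLib

/-!
# Lefschetz correspondences of a polarised complex torus: graph classes, the weight-one Hodge corners,
# `B¹(E × E) = D¹(E × E)`, and invariance under isogeny
# (Milne 1999 §5: Cor. 5.5 / 5.6, Thm. 5.10; Kahn Thm. 6.37)

Layer `Literature/Geometry/Kaehler`, namespace `Literature.Geometry.Kaehler.ComplexTorus.CorrRing`; lane
`lit-hodgefound` (Track 2 foundations library), Layer A4; prover seat `lit-hodgefound-p08`, generation 16, row g16-#4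
(claimed in the lane INBOX 2026-08-23). Sequel of g16-#3 `ComplexTorusCorrespondenceRingIsogenyInvariance.lean`
(`isogenyConj`, `isogenyEquiv`, `isogenyEquivRestrict`) and g16-#2 `ComplexTorusHodgeCorrespondencesWeightOneAlgebraic.lean`
(the weight-one corners `π₁ ∘ u`, `π_{2g-1} ∘ u` of a Hodge correspondence lie in `ℚ[{ᵗ[Γ_f]}]`, `ℚ[{[Γ_f]}]`;
`B¹(E × E) = ℚ[{[Γ_f], ᵗ[Γ_f]}]`), for Q1483's algebra `lefschetzCorr = D^g(X × X)` of LEFSCHETZ correspondences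
(Milne's Lefschetz classes of degree `2g` on `X × X`). CONSUMED BY NAME, nothing restated: the forms-level
Thm. 5.10 `IsRiemannForm.cycleForm_graph_mem_divisorClasses` (`[Γ_f] ∈ D^{g₂}(X₁ × X₂)`, file
`ComplexTorusGraphClassesLefschetz`), `corrComp_mem_divisorClasses` and `compContinuousLinearMap_prodComm_mem_divisorClasses`
(Prop. 5.7's "`φ^*`, `φ_*`, and cupping with a Lefschetz class, all preserve Lefschetz classes"), Q1483's
`lefschetzCorr` / `mem_lefschetzCorr_iff` / `lefschetzCorr_le_hodgeCorr` / `transpose_mem_lefschetzCorr`, Q1562's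
`kunnethIdem_mem_lefschetzCorr` (Cor. 5.8).

## Sources, verbatim

* J. S. Milne, *Lefschetz classes on abelian varieties*, Duke Math. J. 96 (1999), held text
  `paper:doi-10-1215-s0012-7094-99-09620-5` p0025 L44–L50: "**Corollary 5.5.** For any regular map `φ : A → B` of
  abelian varieties, `φ_*` maps Lefschetz classes on `A` to Lefschetz classes on `B`. […] **Corollary 5.6.** The graph
  of any regular map `α : A → B` of abelian varieties is Lefschetz. *Proof.* In fact, `Γ_α = (id_A, α)_*(1_A)`, and
  `1_A ∈ H⁰(A)` is Lefschetz."; §5 Prop. 5.7 (proof) "The maps `φ^*`, `φ_*`, and cupping with a Lefschetz class, all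
  preserve Lefschetz classes"; Thm. 5.10 ("the graph of a regular map of abelian varieties `φ : A → B` is a
  Lefschetz class on `A × B`", as quoted by the tree's `ComplexTorusGraphClassesLefschetz`).
* B. Kahn, *Zeta and L-Functions of Varieties and Motives* (2020), §6.11 Thm. 6.37 (held text p0127 L36–p0128 L8):
  "`h¹ : Ab⁰(k)^op → M_rat(k, Q)` […] fully faithful" — an isogeny induces an isomorphism of motives.

## What is proved (torus level; net Literature debt 0 — one `def` with a body, NO named fact)

`X = E/Φ(ℤ^ι)` a complex torus of dimension `g` with a polarisation `η` (`hη : IsRiemannForm Φ η`; the SET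
`D^g(X × X)` does not depend on `η`), ring data `(e, he, e')`; `A ∈ End(X)`; `u ∈ B^g(X × X) = hodgeCorr`.

* §1 **`graphCorr_mem_lefschetzCorr`: `[Γ_A] ∈ D^g(X × X)`** (Milne Cor. 5.6 / Thm. 5.10 in the ring),
  `transpose_graphCorr_mem_lefschetzCorr` (`ᵗ[Γ_A] ∈ D^g`), `adjoin_graphCorr_union_transpose_le_lefschetzCorr`
  (`ℚ[{[Γ_f], ᵗ[Γ_f]}_f] ⊆ D^g(X × X)`).
* §2 **The weight-one (and the extreme) corners of `B^g(X × X)` are Lefschetz**: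
  `kunnethIdem_one_mul_mem_lefschetzCorr` (`π₁ ∘ u ∈ D^g`), `kunnethIdem_pred_mul_mem_lefschetzCorr` (`π_{2g-1} ∘ u ∈ D^g`),
  `kunnethIdem_zero_mul_mem_lefschetzCorr`, `kunnethIdem_top_mul_mem_lefschetzCorr` (`π₀ ∘ u`, `π_{2g} ∘ u ∈ D^g` for
  rational `u`) — by g16-#2 these corners lie in `ℚ[{ᵗΓ_f}]`, `ℚ[{Γ_f}]`, `ℚπ₀`, `ℚπ_{2g}`.
* §3 `g = 1`: **`hodgeCorr_eq_lefschetzCorr_of_dim_one`: `B¹(E × E) = D¹(E × E)`** in the ring (`B¹ = ℚ[{[Γ_f], ᵗ[Γ_f]}] ⊆ D¹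
  ⊆ B¹`; agrees with the tree's Lefschetz-(1,1) `divisorClasses_one_eq_hodgeClasses` on the product torus, of which
  it is the correspondence-ring reading with explicit generators).
* §4 Two polarised tori, `f = ρ(A) : Y → X` a homomorphism (`N = #Ker f`): **`isogenyConj_mem_lefschetzCorr`:
  `[Γ_f] ∘ D^g(Y × Y) ∘ ᵗ[Γ_f] ⊆ D^g(X × X)`** and `isogenyConjInv_mem_lefschetzCorr` (Cor. 5.5 / Prop. 5.7: push-forward,
  pull-back and composition by the Lefschetz class `[Γ_f]` preserve Lefschetz classes); for an isogeny:
  `isogenyEquiv_mem_lefschetzCorr_iff`, **`lefschetzCorrIsogenyEquiv : D^g(Y × Y) ≃ₐ[ℚ] D^g(X × X)`** (the algebra of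
  Lefschetz correspondences — the endomorphism algebra of `X` in Milne's category of Lefschetz motives modulo
  homological equivalence — is an isogeny invariant), `coe_lefschetzCorrIsogenyEquiv`, `finrank_lefschetzCorr_eq`.

## References

* [Milne1999LefschetzClasses] J. S. Milne, *Lefschetz classes on abelian varieties*, Duke Math. J. 96 (1999),
  639–675, §5 Cor. 5.5, Cor. 5.6, Prop. 5.7, Cor. 5.8, Thm. 5.10.
* [Kahn2020] B. Kahn, *Zeta and L-Functions of Varieties and Motives*, LMS LN 462, CUP (2020), §6.11 Thm. 6.37.
* [Lange2023AbelianVarietiesComplex] H. Lange, *Abelian Varieties over the Complex Numbers*, Springer (2023), §6.2.2.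
-/

noncomputable section

-- Nested instance problems on the carriers (`ℤ`-, `ℚ`- and `ℂ`-module structures on spaces of `ℝ`-multilinear
-- maps) make unification expensive at the default depth (as in the sibling files).
set_option maxSynthPendingDepth 3

open scoped Manifold Matrix
open Set Function Module

namespace Literature.Geometry.Kaehler

namespace ComplexTorus

universe u

namespace CorrRing

/-! ## §0 Plumbing: degree casts `g + g = 2g` of cycle classes and transposes -/

section Plumbing

variable {κ ι : Type*} [Fintype κ] [Fintype ι] [DecidableEq κ] [DecidableEq ι] {F E : Type u}
  [NormedAddCommGroup F] [NormedSpace ℂ F] [NormedAddCommGroup E] [NormedSpace ℂ E]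
  (Ψ : (κ → ℝ) ≃L[ℝ] F) (Φ : (ι → ℝ) ≃L[ℝ] E)

/-- A cycle class under a degree cast is the cycle class in the cast presentation. [folklore] -/
private theorem cycleForm_domDomCongr_finCongr {m k k' : ℕ} (hk : k = k') (Z : SubtorusFrame (prodPeriod Ψ Φ) m)
    (e₁ : Fin (m + k) ≃ κ ⊕ ι) (e₂ : Fin (m + k') ≃ κ ⊕ ι) :
    (Z.cycleForm e₁).domDomCongr (finCongr hk) = Z.cycleForm e₂ := by
  subst hk
  rw [domDomCongr_finCongr_self]
  exact cycleFormOfFrame_eq_of_enum _ e₁ e₂ Z.frame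

omit [Fintype κ] [Fintype ι] [DecidableEq κ] [DecidableEq ι] in
/-- The degree cast of a transpose is the swap pull-back of the degree cast. [folklore] -/
private theorem corrTranspose_domDomCongr₂ {d l n : ℕ} (h : d + l = n) (h' : l + d = n)
    (γ : (F × E) [⋀^Fin (d + l)]→L[ℝ] ℂ) :
    (corrTranspose (d := d) (l := l) γ).domDomCongr (finCongr h') =
      (γ.domDomCongr (finCongr h)).compContinuousLinearMap
        (ContinuousLinearEquiv.prodComm ℝ E F : E × F →L[ℝ] F × E) := by
  subst h
  ext v
  rfl

omit [Fintype ι] in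
/-- The orientation sign is unchanged by a degree cast of the enumeration. [folklore] -/
private theorem orientationSign_finCongr_trans₁₆ {n N : ℕ} (h : n = N) (f : Fin N ≃ ι) :
    orientationSign Φ ((finCongr h).trans f) = orientationSign Φ f := by
  subst h
  have hf : (finCongr (rfl : n = n)).trans f = f := Equiv.ext fun _ ↦ rfl
  rw [hf]

end Plumbing

section OneTorus

variable {ι : Type*} [Fintype ι] [DecidableEq ι] {E : Type u} [NormedAddCommGroup E] [NormedSpace ℂ E]
  [FiniteDimensional ℂ E] (Φ : (ι → ℝ) ≃L[ℝ] E) {g : ℕ} (e : Fin (g + g) ≃ ι) (he : orientationSign Φ e = 1)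
  (e' : Fin ((g + g) + (g + g)) ≃ ι ⊕ ι) {η : E [⋀^Fin 2]→L[ℝ] ℝ}

/-! ## §1 Graph classes are Lefschetz correspondences (Milne Cor. 5.6 / Thm. 5.10 in the ring) -/

/-- **`[Γ_A] ∈ D^g(X × X)`: the graph class of every endomorphism of a polarised complex torus is a LEFSCHETZ
correspondence** ("The graph of any regular map `α : A → B` of abelian varieties is Lefschetz", Cor. 5.6; the
tree's forms-level Thm. 5.10 `IsRiemannForm.cycleForm_graph_mem_divisorClasses`, read through the ring's degree
presentation `g + g = 2g`). [cite: Milne1999LefschetzClasses, §5 Cor. 5.6 and Thm. 5.10] -/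
theorem graphCorr_mem_lefschetzCorr (hη : IsRiemannForm Φ η) (A : endRingInt Φ) :
    graphCorr Φ e he e' A ∈ lefschetzCorr Φ e he e' hη := by
  have h2 : 2 * g = g + g := by omega
  rw [mem_lefschetzCorr_iff, toForm_graphCorr,
    cycleForm_domDomCongr_finCongr Φ Φ (by omega : g + g = 2 * g) _ e'
      ((finCongr (by omega : (g + g) + 2 * g = (g + g) + (g + g))).trans e')]
  exact IsRiemannForm.cycleForm_graph_mem_divisorClasses Φ Φ e he (apply_mulVec_endRingInt Φ A)
    ((finCongr h2).trans e) hη _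

/-- **`ᵗ[Γ_A] ∈ D^g(X × X)`** (the transpose of a Lefschetz correspondence is Lefschetz,
`transpose_mem_lefschetzCorr`). [cite: Milne1999LefschetzClasses, §5 Cor. 5.6 and Prop. 5.7 (proof)] -/
theorem transpose_graphCorr_mem_lefschetzCorr (hη : IsRiemannForm Φ η) (A : endRingInt Φ) :
    transpose Φ e he e' (graphCorr Φ e he e' A) ∈ lefschetzCorr Φ e he e' hη :=
  transpose_mem_lefschetzCorr Φ e he e' hη (graphCorr_mem_lefschetzCorr Φ e he e' hη A)

/-- **`ℚ[{[Γ_f], ᵗ[Γ_f]}_{f ∈ End(X)}] ⊆ D^g(X × X)`**: the `ℚ`-algebra generated under `∘` by the graph classes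
and their transposes consists of Lefschetz correspondences (`D^g(X × X)` is a `ℚ`-algebra containing them).
[cite: Milne1999LefschetzClasses, §5 Cor. 5.6 and Prop. 5.7] -/
theorem adjoin_graphCorr_union_transpose_le_lefschetzCorr (hη : IsRiemannForm Φ η) :
    Algebra.adjoin ℚ (Set.range (graphCorr Φ e he e') ∪
        Set.range fun A : endRingInt Φ ↦ transpose Φ e he e' (graphCorr Φ e he e' A)) ≤
      lefschetzCorr Φ e he e' hη := by
  refine Algebra.adjoin_le ?_
  rintro _ (⟨A, rfl⟩ | ⟨A, rfl⟩)
  · exact graphCorr_mem_lefschetzCorr Φ e he e' hη A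
  · exact transpose_graphCorr_mem_lefschetzCorr Φ e he e' hη A

/-! ## §2 The weight-one and the extreme corners of `B^g(X × X)` are Lefschetz -/

/-- **`π₁ ∘ u ∈ D^g(X × X)` for every Hodge correspondence `u ∈ B^g(X × X)`**: by g16-#2, `π₁ ∘ u ∈ ℚ[{ᵗ[Γ_f]}]`
(Deligne–Milne / Kahn: the `(2g-1, 1)`-Künneth component of a Hodge class on `X × X` comes from `End_ℚ(X)`), and
the transposed graphs are Lefschetz (§1) — the weight-one corner of the algebra of Hodge correspondences is
Lefschetz for EVERY polarised complex torus. [cite: Milne1999LefschetzClasses, §5 Cor. 5.6 and Prop. 5.7]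
[cite: Kahn2020, §6.11 Thm. 6.37] -/
theorem kunnethIdem_one_mul_mem_lefschetzCorr (hη : IsRiemannForm Φ η) {u : CorrRing Φ e he e'}
    (hu : u ∈ hodgeCorr Φ e he e') : kunnethIdem Φ e he e' 1 * u ∈ lefschetzCorr Φ e he e' hη :=
  (Algebra.adjoin_mono Set.subset_union_right).trans (adjoin_graphCorr_union_transpose_le_lefschetzCorr Φ e he e' hη)
    (kunnethIdem_one_mul_mem_adjoin_of_mem_hodgeCorr Φ e he e' hu)

/-- **`π_{2g-1} ∘ u ∈ D^g(X × X)` for every `u ∈ B^g(X × X)`** (g16-#2: `π_{2g-1} ∘ u ∈ ℚ[{[Γ_f]}]`; §1).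
[cite: Milne1999LefschetzClasses, §5 Cor. 5.6 and Prop. 5.7] [cite: Kahn2020, §6.11 Thm. 6.37] -/
theorem kunnethIdem_pred_mul_mem_lefschetzCorr (hη : IsRiemannForm Φ η) {u : CorrRing Φ e he e'}
    (hu : u ∈ hodgeCorr Φ e he e') : kunnethIdem Φ e he e' (g + g - 1) * u ∈ lefschetzCorr Φ e he e' hη :=
  (Algebra.adjoin_mono Set.subset_union_left).trans (adjoin_graphCorr_union_transpose_le_lefschetzCorr Φ e he e' hη)
    (kunnethIdem_pred_mul_mem_adjoin_of_mem_hodgeCorr Φ e he e' hu)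

/-- `π₀ ∘ u ∈ D^g(X × X)` for every rational correspondence `u` (`π₀ ∘ u = c π₀`, and `π₀` is Lefschetz, Cor. 5.8).
[cite: Milne1999LefschetzClasses, §5 Cor. 5.8] -/
theorem kunnethIdem_zero_mul_mem_lefschetzCorr (hη : IsRiemannForm Φ η) {u : CorrRing Φ e he e'}
    (hu : u ∈ ratCorr Φ e he e') : kunnethIdem Φ e he e' 0 * u ∈ lefschetzCorr Φ e he e' hη := by
  obtain ⟨c, hc⟩ := exists_kunnethIdem_zero_mul_eq_smul Φ e he e' hu
  rw [hc]
  exact Subalgebra.smul_mem _ (kunnethIdem_mem_lefschetzCorr Φ e he e' hη 0) c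

/-- `π_{2g} ∘ u ∈ D^g(X × X)` for every rational correspondence `u`. [cite: Milne1999LefschetzClasses, §5 Cor. 5.8] -/
theorem kunnethIdem_top_mul_mem_lefschetzCorr (hη : IsRiemannForm Φ η) {u : CorrRing Φ e he e'}
    (hu : u ∈ ratCorr Φ e he e') : kunnethIdem Φ e he e' (g + g) * u ∈ lefschetzCorr Φ e he e' hη := by
  obtain ⟨c, hc⟩ := exists_kunnethIdem_top_mul_eq_smul Φ e he e' hu
  rw [hc]
  exact Subalgebra.smul_mem _ (kunnethIdem_mem_lefschetzCorr Φ e he e' hη (g + g)) c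

end OneTorus

/-! ## §3 `g = 1`: `B¹(E × E) = D¹(E × E)` in the ring of correspondences -/

section EllipticCurve

variable {ι : Type*} [Fintype ι] [DecidableEq ι] {E : Type u} [NormedAddCommGroup E] [NormedSpace ℂ E]
  [FiniteDimensional ℂ E] (Φ : (ι → ℝ) ≃L[ℝ] E) (e : Fin (1 + 1) ≃ ι) (he : orientationSign Φ e = 1)
  (e' : Fin ((1 + 1) + (1 + 1)) ≃ ι ⊕ ι) {η : E [⋀^Fin 2]→L[ℝ] ℝ}

/-- **`B¹(E × E) = D¹(E × E)`: on the square of a one-dimensional complex torus every Hodge correspondence is a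
Lefschetz correspondence** — `B¹ = ℚ[{[Γ_f], ᵗ[Γ_f]}]` (g16-#2's Hodge conjecture for `E × E`,
`hodgeCorr_eq_adjoin_of_dim_one`) `⊆ D¹` (§1) `⊆ B¹`. (The tree's Lefschetz-(1,1) theorem
`divisorClasses_one_eq_hodgeClasses` for the product torus gives the same equality of sets of classes; this is its
correspondence-ring reading with explicit algebraic generators.) [cite: Milne1999LefschetzClasses, §5 Cor. 5.6 and Thm. 5.10]
[cite: Kahn2020, §6.11 Thm. 6.37] -/
theorem hodgeCorr_eq_lefschetzCorr_of_dim_one (hη : IsRiemannForm Φ η) :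
    hodgeCorr Φ e he e' = lefschetzCorr Φ e he e' hη :=
  le_antisymm ((hodgeCorr_le_adjoin_of_dim_one Φ e he e').trans
      (adjoin_graphCorr_union_transpose_le_lefschetzCorr Φ e he e' hη))
    (lefschetzCorr_le_hodgeCorr Φ e he e' hη)

end EllipticCurve

/-! ## §4 Two polarised tori: `κ_f` preserves Lefschetz correspondences; `D^g(Y × Y) ≃ₐ[ℚ] D^g(X × X)` -/

section TwoTori

variable {κ ι : Type*} [Fintype κ] [Fintype ι] [DecidableEq κ] [DecidableEq ι] {F E : Type u}
  [NormedAddCommGroup F] [NormedSpace ℂ F] [FiniteDimensional ℂ F] [NormedAddCommGroup E] [NormedSpace ℂ E]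
  [FiniteDimensional ℂ E] (Ψ : (κ → ℝ) ≃L[ℝ] F) (Φ : (ι → ℝ) ≃L[ℝ] E) {g : ℕ}
  (eY : Fin (g + g) ≃ κ) (heY : orientationSign Ψ eY = 1) (eY' : Fin ((g + g) + (g + g)) ≃ κ ⊕ κ)
  (eX : Fin (g + g) ≃ ι) (heX : orientationSign Φ eX = 1) (eX' : Fin ((g + g) + (g + g)) ≃ ι ⊕ ι)
  {L : F →L[ℂ] E} {A : Matrix ι κ ℤ}
  (hA : ∀ x : κ → ℝ, Φ ((A.map (Int.cast : ℤ → ℝ)).mulVec x) = L (Ψ x))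
  (e : Fin ((g + g) + (g + g)) ≃ κ ⊕ ι)
  {ηY : F [⋀^Fin 2]→L[ℝ] ℝ} {ηX : E [⋀^Fin 2]→L[ℝ] ℝ}

omit [FiniteDimensional ℂ F] in
include eX in
/-- `[Γ_f] ∈ D^g(Y × X)` in the cast presentation: the graph class of `f : Y → X` into the polarised torus `X`,
read in degree `2g`. [cite: Milne1999LefschetzClasses, §5 Thm. 5.10] -/
private theorem graph_domDomCongr_mem_divisorClasses (hηX : IsRiemannForm Φ ηX) (h : g + g = 2 * g) :
    ((SubtorusFrame.graph Ψ Φ eY heY L A hA).cycleForm e).domDomCongr (finCongr h) ∈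
      divisorClasses (prodPeriod Ψ Φ) g := by
  have h2 : 2 * g = g + g := by omega
  rw [cycleForm_domDomCongr_finCongr Ψ Φ h _ e
    ((finCongr (by omega : (g + g) + 2 * g = (g + g) + (g + g))).trans e)]
  exact IsRiemannForm.cycleForm_graph_mem_divisorClasses Ψ Φ eY heY hA ((finCongr h2).trans eX) hηX _

omit [FiniteDimensional ℂ F] in
include eX in
/-- `ᵗ[Γ_f] ∈ D^g(X × Y)` in the cast presentation. [cite: Milne1999LefschetzClasses, §5 Thm. 5.10 and Prop. 5.7 (proof)] -/
private theorem corrTranspose_graph_domDomCongr_mem_divisorClasses (hηX : IsRiemannForm Φ ηX) (h : g + g = 2 * g) :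
    (corrTranspose ((SubtorusFrame.graph Ψ Φ eY heY L A hA).cycleForm e)).domDomCongr (finCongr h) ∈
      divisorClasses (prodPeriod Φ Ψ) g := by
  rw [corrTranspose_domDomCongr₂ (E := E) (F := F) h h]
  exact compContinuousLinearMap_prodComm_mem_divisorClasses Ψ Φ
    (graph_domDomCongr_mem_divisorClasses Ψ Φ eY heY eX hA e hηX h)

/-- **`κ_f(D^g(Y × Y)) ⊆ D^g(X × X)`: conjugation by the graph of a homomorphism of polarised tori maps Lefschetz
correspondences to Lefschetz correspondences** — `[Γ_f]`, `ᵗ[Γ_f]` are Lefschetz (Thm. 5.10) and the composition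
of Lefschetz correspondences is Lefschetz (proof of Prop. 5.7: "`φ^*`, `φ_*`, and cupping with a Lefschetz class,
all preserve Lefschetz classes"; Cor. 5.5). [cite: Milne1999LefschetzClasses, §5 Cor. 5.5, Prop. 5.7 (proof) and Thm. 5.10] -/
theorem isogenyConj_mem_lefschetzCorr (hηY : IsRiemannForm Ψ ηY) (hηX : IsRiemannForm Φ ηX)
    {u : CorrRing Ψ eY heY eY'} (hu : u ∈ lefschetzCorr Ψ eY heY eY' hηY) :
    isogenyConj Ψ Φ eY heY eY' eX heX eX' hA e u ∈ lefschetzCorr Φ eX heX eX' hηX := by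
  have h : g + g = 2 * g := by omega
  rw [mem_lefschetzCorr_iff, toForm_isogenyConj]
  exact corrComp_mem_divisorClasses Φ Ψ Φ hηX.isNSForm (hηX.exists_apply_ne_zero Φ) hηY.isNSForm
    (hηY.exists_apply_ne_zero Ψ) hηX.isNSForm (hηX.exists_apply_ne_zero Φ) eY h h h
    (graph_domDomCongr_mem_divisorClasses Ψ Φ eY heY eX hA e hηX h)
    (corrComp_mem_divisorClasses Φ Ψ Ψ hηX.isNSForm (hηX.exists_apply_ne_zero Φ) hηY.isNSForm
      (hηY.exists_apply_ne_zero Ψ) hηY.isNSForm (hηY.exists_apply_ne_zero Ψ) eY h h h hu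
      (corrTranspose_graph_domDomCongr_mem_divisorClasses Ψ Φ eY heY eX hA e hηX h))

/-- **`κ′_f(D^g(X × X)) ⊆ D^g(Y × Y)`** (the same for the opposite conjugation `ᵗ[Γ_f] ∘ (·) ∘ [Γ_f]`).
[cite: Milne1999LefschetzClasses, §5 Cor. 5.5, Prop. 5.7 (proof) and Thm. 5.10] -/
theorem isogenyConjInv_mem_lefschetzCorr (hηY : IsRiemannForm Ψ ηY) (hηX : IsRiemannForm Φ ηX)
    {w : CorrRing Φ eX heX eX'} (hw : w ∈ lefschetzCorr Φ eX heX eX' hηX) :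
    isogenyConjInv Ψ Φ eY heY eY' eX heX eX' hA e w ∈ lefschetzCorr Ψ eY heY eY' hηY := by
  have h : g + g = 2 * g := by omega
  rw [mem_lefschetzCorr_iff, toForm_isogenyConjInv]
  exact corrComp_mem_divisorClasses Ψ Φ Ψ hηY.isNSForm (hηY.exists_apply_ne_zero Ψ) hηX.isNSForm
    (hηX.exists_apply_ne_zero Φ) hηY.isNSForm (hηY.exists_apply_ne_zero Ψ) eX h h h
    (corrTranspose_graph_domDomCongr_mem_divisorClasses Ψ Φ eY heY eX hA e hηX h)
    (corrComp_mem_divisorClasses Ψ Φ Φ hηY.isNSForm (hηY.exists_apply_ne_zero Ψ) hηX.isNSForm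
      (hηX.exists_apply_ne_zero Φ) hηX.isNSForm (hηX.exists_apply_ne_zero Φ) eX h h h hw
      (graph_domDomCongr_mem_divisorClasses Ψ Φ eY heY eX hA e hηX h))

section Isogeny

variable (hN : Nat.card (mapMatrixHom Ψ Φ A).ker ≠ 0)

/-- A rational multiple `N⁻¹ · a` of an element of a `ℚ`-subalgebra lies in it. [folklore] -/
private theorem inv_natCast_smul_mem₂ {ι₀ : Type*} [Fintype ι₀] [DecidableEq ι₀] {E₀ : Type u}
    [NormedAddCommGroup E₀] [NormedSpace ℂ E₀] {Φ₀ : (ι₀ → ℝ) ≃L[ℝ] E₀} {g₀ : ℕ} {e₀ : Fin (g₀ + g₀) ≃ ι₀}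
    {he₀ : orientationSign Φ₀ e₀ = 1} {e₀' : Fin ((g₀ + g₀) + (g₀ + g₀)) ≃ ι₀ ⊕ ι₀}
    (S : Subalgebra ℚ (CorrRing Φ₀ e₀ he₀ e₀')) (N : ℕ) {a : CorrRing Φ₀ e₀ he₀ e₀'} (ha : a ∈ S) :
    (N : ℂ)⁻¹ • a ∈ S := by
  have h : (N : ℂ)⁻¹ • a = ((N : ℚ)⁻¹ : ℚ) • a := by
    rw [← Rat.cast_smul_eq_qsmul ℂ, Rat.cast_inv, Rat.cast_natCast]
  rw [h]
  exact S.smul_mem ha _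

/-- **`u ∈ D^g(Y × Y) ↔ isogenyEquiv u ∈ D^g(X × X)`** for an isogeny `f : Y → X` of polarised tori.
[cite: Milne1999LefschetzClasses, §5 Cor. 5.5 and Prop. 5.7 (proof)] [cite: Kahn2020, §6.11 Thm. 6.37] -/
theorem isogenyEquiv_mem_lefschetzCorr_iff (hηY : IsRiemannForm Ψ ηY) (hηX : IsRiemannForm Φ ηX)
    (u : CorrRing Ψ eY heY eY') :
    isogenyEquiv Ψ Φ eY heY eY' eX heX eX' hA e hN u ∈ lefschetzCorr Φ eX heX eX' hηX ↔
      u ∈ lefschetzCorr Ψ eY heY eY' hηY := by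
  refine ⟨fun h ↦ ?_, fun h ↦ ?_⟩
  · rw [← (isogenyEquiv Ψ Φ eY heY eY' eX heX eX' hA e hN).symm_apply_apply u, isogenyEquiv_symm_apply]
    exact inv_natCast_smul_mem₂ _ _ (isogenyConjInv_mem_lefschetzCorr Ψ Φ eY heY eY' eX heX eX' hA e hηY hηX h)
  · rw [isogenyEquiv_apply]
    exact inv_natCast_smul_mem₂ _ _ (isogenyConj_mem_lefschetzCorr Ψ Φ eY heY eY' eX heX eX' hA e hηY hηX h)

/-- **`D^g(Y × Y) ≃ₐ[ℚ] D^g(X × X)` for an isogeny `f : Y → X` of polarised complex tori: THE ALGEBRA OF LEFSCHETZ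
CORRESPONDENCES IS AN ISOGENY INVARIANT** — `u ↦ (deg f)⁻¹ · [Γ_f] ∘ u ∘ ᵗ[Γ_f]` (g16-#3's `isogenyEquiv` restricted
by `isogenyEquivRestrict`): the endomorphism algebra of `X` in Milne's category of Lefschetz motives modulo
homological equivalence depends only on the isogeny class. [cite: Milne1999LefschetzClasses, §5 Cor. 5.5, Prop. 5.7 and Thm. 5.10]
[cite: Kahn2020, §6.11 Thm. 6.37] -/
def lefschetzCorrIsogenyEquiv (hηY : IsRiemannForm Ψ ηY) (hηX : IsRiemannForm Φ ηX) :
    lefschetzCorr Ψ eY heY eY' hηY ≃ₐ[ℚ] lefschetzCorr Φ eX heX eX' hηX :=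
  isogenyEquivRestrict Ψ Φ eY heY eY' eX heX eX' hA e hN _ _
    (isogenyEquiv_mem_lefschetzCorr_iff Ψ Φ eY heY eY' eX heX eX' hA e hN hηY hηX)

/-- Unfolding of `lefschetzCorrIsogenyEquiv`. [cite: Kahn2020, §6.11 Thm. 6.37] -/
theorem coe_lefschetzCorrIsogenyEquiv (hηY : IsRiemannForm Ψ ηY) (hηX : IsRiemannForm Φ ηX)
    (u : lefschetzCorr Ψ eY heY eY' hηY) :
    (lefschetzCorrIsogenyEquiv Ψ Φ eY heY eY' eX heX eX' hA e hN hηY hηX u : CorrRing Φ eX heX eX') =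
      isogenyEquiv Ψ Φ eY heY eY' eX heX eX' hA e hN u :=
  rfl

include hA hN e heY heX in
/-- **`dim_ℚ D^g(Y × Y) = dim_ℚ D^g(X × X)` for isogenous polarised tori.** [cite: Milne1999LefschetzClasses, §5 Cor. 5.5 and Thm. 5.10]
[cite: Kahn2020, §6.11 Thm. 6.37] -/
theorem finrank_lefschetzCorr_eq (hηY : IsRiemannForm Ψ ηY) (hηX : IsRiemannForm Φ ηX) :
    finrank ℚ (lefschetzCorr Ψ eY heY eY' hηY) = finrank ℚ (lefschetzCorr Φ eX heX eX' hηX) :=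
  (lefschetzCorrIsogenyEquiv Ψ Φ eY heY eY' eX heX eX' hA e hN hηY hηX).toLinearEquiv.finrank_eq

end Isogeny

end TwoTori

/-! ### §4′ Packaging over the tree's `IsIsogenous` -/

section Packaged

variable {κ ι : Type*} [Fintype κ] [Fintype ι] [DecidableEq κ] [DecidableEq ι] {F E : Type u}
  [NormedAddCommGroup F] [NormedSpace ℂ F] [FiniteDimensional ℂ F] [NormedAddCommGroup E] [NormedSpace ℂ E]
  [FiniteDimensional ℂ E] {Ψ : (κ → ℝ) ≃L[ℝ] F} {Φ : (ι → ℝ) ≃L[ℝ] E} {g : ℕ}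
  {ηY : F [⋀^Fin 2]→L[ℝ] ℝ} {ηX : E [⋀^Fin 2]→L[ℝ] ℝ}

/-- **The algebras of Lefschetz correspondences of isogenous polarised complex tori are isomorphic `ℚ`-algebras.**
[cite: Milne1999LefschetzClasses, §5 Cor. 5.5, Prop. 5.7 and Thm. 5.10] [cite: Kahn2020, §6.11 Thm. 6.37] -/
theorem _root_.Literature.Geometry.Kaehler.ComplexTorus.IsIsogenous.nonempty_lefschetzCorr_algEquiv
    (h : IsIsogenous Ψ Φ) (hηY : IsRiemannForm Ψ ηY) (hηX : IsRiemannForm Φ ηX)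
    (eY : Fin (g + g) ≃ κ) (heY : orientationSign Ψ eY = 1) (eY' : Fin ((g + g) + (g + g)) ≃ κ ⊕ κ)
    (eX : Fin (g + g) ≃ ι) (heX : orientationSign Φ eX = 1) (eX' : Fin ((g + g) + (g + g)) ≃ ι ⊕ ι) :
    Nonempty (lefschetzCorr Ψ eY heY eY' hηY ≃ₐ[ℚ] lefschetzCorr Φ eX heX eX' hηX) := by
  obtain ⟨A, hA⟩ := h
  obtain ⟨L, hL⟩ := hA.exists_analyticRep
  exact ⟨lefschetzCorrIsogenyEquiv Ψ Φ eY heY eY' eX heX eX' hL (finSumFinEquiv.symm.trans (eY.sumCongr eX))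
    hA.natCard_ker_ne_zero hηY hηX⟩

/-- **`dim_ℚ D^g(Y × Y) = dim_ℚ D^g(X × X)` for isogenous polarised complex tori.**
[cite: Milne1999LefschetzClasses, §5 Cor. 5.5 and Thm. 5.10] [cite: Kahn2020, §6.11 Thm. 6.37] -/
theorem _root_.Literature.Geometry.Kaehler.ComplexTorus.IsIsogenous.finrank_lefschetzCorr_eq
    (h : IsIsogenous Ψ Φ) (hηY : IsRiemannForm Ψ ηY) (hηX : IsRiemannForm Φ ηX)
    (eY : Fin (g + g) ≃ κ) (heY : orientationSign Ψ eY = 1) (eY' : Fin ((g + g) + (g + g)) ≃ κ ⊕ κ)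
    (eX : Fin (g + g) ≃ ι) (heX : orientationSign Φ eX = 1) (eX' : Fin ((g + g) + (g + g)) ≃ ι ⊕ ι) :
    finrank ℚ (lefschetzCorr Ψ eY heY eY' hηY) = finrank ℚ (lefschetzCorr Φ eX heX eX' hηX) := by
  obtain ⟨φ⟩ := h.nonempty_lefschetzCorr_algEquiv hηY hηX eY heY eY' eX heX eX'
  exact φ.toLinearEquiv.finrank_eq

end Packaged

end CorrRing

end ComplexTorus

end Literature.Geometry.Kaehler

end
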